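import Literature.NumberTheory.EllipticCurves.TwistRootNumberModularityProofs
import Literature.NumberTheory.EllipticCurves.QuadraticTwistNegOneLFunctionProofs
import HarnessLib

/-!
# The root number of the quadratic twist by `−1`, from the Modularity Theorem

Let `E/ℚ` be an elliptic curve of **odd** conductor `N` (good reduction at `2`), and `E^{(−1)}` its
quadratic twist by `ℚ(i)` (`W.quadraticTwist (−1)`), assumed additive at `2` (hypothesis `hadd`, see
`QuadraticTwistNegOneLFunctionProofs`). Then (Murty–Murty 1997, Ch. 6, §1, with the fundamental
discriminant `D = −4`, `(D, N) = 1`: the sign of `L_D(s, f)` is `ω χ_D(−N)`; Atkin–Lehner 1970, §6)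

* `w(E^{(−1)}) = χ_{−4}(−N) w(E) = −χ₄(N) w(E)` for the tree's analytic root numbers, and
* `N_{E^{(−1)}} = 16 N`,

both from the Modularity Theorem `exists_isNewformOf` alone (`rootNumber_quadraticTwist_neg_one`):
`aₙ(E^{(−1)}) = χ₄(n) aₙ(E)` (`LFunction_quadraticTwist_neg_one_apply_complex`) feeds the coprime
twisting theorem `rootNumber_eq_of_cuspCoeff_eq_twist` (`TwistRootNumberModularityProofs`) with the
primitive quadratic character `χ₄ ⊗ ℂ` mod `4`. In particular the twist by `−1` **reverses** the root
number when `N ≡ 1 (mod 4)` and preserves it when `N ≡ 3 (mod 4)`.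

Everything is proved; no definitions and no named facts are introduced (D-0026).

## References

* [MurtyMurty1997] M. R. Murty, V. K. Murty, *Non-vanishing of `L`-functions and applications*
  (1997), Ch. 6, §1.
* [AtkinLehner1970] A. O. L. Atkin, J. Lehner, *Hecke operators on `Γ₀(m)`*, Math. Ann. 185 (1970), §6.
-/

noncomputable section

open scoped Classical

namespace WeierstrassCurve

open IsDedekindDomain IsDedekindDomain.HeightOneSpectrum NumberField Rat.HeightOneSpectrum
  Literature.NumberTheory.EllipticCurves.ModularForms Literature.NumberTheory.EllipticCurves

variable (W : WeierstrassCurve ℚ) [W.IsElliptic]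

/-- **Root number and conductor of `E^{(−1)}` for `E` of odd conductor** (Murty–Murty 1997, Ch. 6,
§1, `D = −4`; Atkin–Lehner 1970, §6): if `N = N_E` is odd and `E^{(−1)}` is additive at `2`, then
`w(E^{(−1)}) = −χ₄(N) w(E)` and `N_{E^{(−1)}} = 16 N`, from the Modularity Theorem.
[cite: MurtyMurty1997, Ch. 6 §1] [cite: AtkinLehner1970, §6] -/
theorem rootNumber_quadraticTwist_neg_one (hmod : exists_isNewformOf)
    (hN2 : ¬ 2 ∣ W.conductorNorm ℤ)
    (hadd : ∀ v : HeightOneSpectrum (𝓞 ℚ), (primesEquiv v : ℕ) = 2 →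
      (W.quadraticTwist (-1)).HasAdditiveReductionAt v) :
    (W.quadraticTwist (-1)).rootNumber = -ZMod.χ₄ (W.conductorNorm ℤ) * W.rootNumber ∧
      (W.quadraticTwist (-1)).conductorNorm ℤ = 16 * W.conductorNorm ℤ := by
  haveI : (W.quadraticTwist (-1 : ℚ)).IsElliptic := W.isElliptic_quadraticTwist (by norm_num)
  haveI : NeZero (4 : ℕ) := ⟨by norm_num⟩
  have hNm : (W.conductorNorm ℤ).Coprime 4 := by
    have h2 : (W.conductorNorm ℤ).Coprime 2 := (Nat.prime_two.coprime_iff_not_dvd.mpr hN2).symm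
    have := h2.pow_right 2
    norm_num at this
    exact this
  have h := rootNumber_eq_of_cuspCoeff_eq_twist W hmod hNm isQuadratic_χ₄_ringHomComp
    isPrimitive_χ₄_ringHomComp (W.quadraticTwist (-1))
    (W.LFunction_quadraticTwist_neg_one_apply_complex hadd)
  refine ⟨?_, by rw [h.2]; ring⟩
  have h1 := h.1
  rw [χ₄_ringHomComp_neg_one, χ₄_ringHomComp_apply_natCast] at h1
  have h' : (((W.quadraticTwist (-1)).rootNumber : ℤ) : ℂ) =
      ((-ZMod.χ₄ (W.conductorNorm ℤ) * W.rootNumber : ℤ) : ℂ) := by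
    rw [h1]; push_cast; ring
  exact_mod_cast h'

/-- **`N ≡ 1 (mod 4)`: the twist by `−1` reverses the root number**, `w(E^{(−1)}) = −w(E)`
(Murty–Murty 1997, Ch. 6, §1: sign `ω χ_{−4}(−N) = −ω`). [cite: MurtyMurty1997, Ch. 6 §1] -/
theorem rootNumber_quadraticTwist_neg_one_of_mod_four_eq_one (hmod : exists_isNewformOf)
    (hN : W.conductorNorm ℤ % 4 = 1)
    (hadd : ∀ v : HeightOneSpectrum (𝓞 ℚ), (primesEquiv v : ℕ) = 2 →
      (W.quadraticTwist (-1)).HasAdditiveReductionAt v) :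
    (W.quadraticTwist (-1)).rootNumber = -W.rootNumber := by
  have h := (W.rootNumber_quadraticTwist_neg_one hmod (by omega) hadd).1
  rw [ZMod.χ₄_nat_one_mod_four hN] at h
  simpa using h

/-- **`N ≡ 3 (mod 4)`: the twist by `−1` preserves the root number**, `w(E^{(−1)}) = w(E)`
(Murty–Murty 1997, Ch. 6, §1: sign `ω χ_{−4}(−N) = ω`). [cite: MurtyMurty1997, Ch. 6 §1] -/
theorem rootNumber_quadraticTwist_neg_one_of_mod_four_eq_three (hmod : exists_isNewformOf)
    (hN : W.conductorNorm ℤ % 4 = 3)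
    (hadd : ∀ v : HeightOneSpectrum (𝓞 ℚ), (primesEquiv v : ℕ) = 2 →
      (W.quadraticTwist (-1)).HasAdditiveReductionAt v) :
    (W.quadraticTwist (-1)).rootNumber = W.rootNumber := by
  have h := (W.rootNumber_quadraticTwist_neg_one hmod (by omega) hadd).1
  rw [ZMod.χ₄_nat_three_mod_four hN] at h
  simpa using h

/-- **Conductor of `E^{(−1)}` for `E` of odd conductor**: `N_{E^{(−1)}} = 16 N_E` (the level of the
twisted newform `f ⊗ χ_{−4}`; Atkin–Lehner 1970, §6). [cite: AtkinLehner1970, §6] -/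
theorem conductorNorm_quadraticTwist_neg_one (hmod : exists_isNewformOf)
    (hN2 : ¬ 2 ∣ W.conductorNorm ℤ)
    (hadd : ∀ v : HeightOneSpectrum (𝓞 ℚ), (primesEquiv v : ℕ) = 2 →
      (W.quadraticTwist (-1)).HasAdditiveReductionAt v) :
    (W.quadraticTwist (-1)).conductorNorm ℤ = 16 * W.conductorNorm ℤ :=
  (W.rootNumber_quadraticTwist_neg_one hmod hN2 hadd).2

end WeierstrassCurve

end
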